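import Summits.AtomisticToContinuum.HydrodynamicLimit.Theses.JParityClosure
import Literature.MathematicalPhysics.KineticTheory.EvenCollisionTubeFunctional
import Literature.MathematicalPhysics.KineticTheory.CollisionTailMarks
import Literature.MathematicalPhysics.KineticTheory.MicroscaleWindowFunctionals
import Literature.MathematicalPhysics.KineticTheory.EvenStatTruncationBound
import Summits.AtomisticToContinuum.HydrodynamicLimit.Theorems.EvenStressEnskog.Negative.ContactValueZero
import Summits.AtomisticToContinuum.HydrodynamicLimit.Theorems.EvenStressEnskog.Negative.PairFunctionalVanishing
import Summits.AtomisticToContinuum.HydrodynamicLimit.Theorems.EvenStressEnskog.Negative.FrequencyLawReduction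
import Summits.AtomisticToContinuum.HydrodynamicLimit.Theorems.EvenStressEnskog.Negative.SwappedOrderTrivial
import Summits.AtomisticToContinuum.HydrodynamicLimit.Theorems.EvenStressEnskog.Negative.EnskogSideMoments
import Summits.AtomisticToContinuum.HydrodynamicLimit.Theorems.JParityClosureEvenStressEnskogKineticEnergyTight
import Summits.AtomisticToContinuum.HydrodynamicLimit.Theorems.JParityClosureEvenStressEnskogVelocityTruncationOfTails
import Summits.AtomisticToContinuum.HydrodynamicLimit.Theorems.JParityClosureEvenStressEnskogClusterTransport
import Summits.AtomisticToContinuum.HydrodynamicLimit.Theorems.JParityClosureEvenStressEnskogEnskogPointwise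
import Summits.AtomisticToContinuum.HydrodynamicLimit.Theorems.JParityClosureEvenStressEnskogMicroStationarity
import Summits.AtomisticToContinuum.HydrodynamicLimit.Theorems.JParityClosureEvenStressEnskogEnskogIdentification

/-!
# Line `stationary-microscale-hierarchy-entrance-law` for crux `JParityClosure.EvenStressEnskog`
# (stmt-AtomisticToContinuum-13079) — LEAD c4 RESHAPE v3 (of lead c3's reshape v2, lead c2's reshape v1)

## Lead c4 reshape v3 (prover-line-stmt-AtomisticToContinuum-13079-c4-0, continuation seat of lead c3; what changed)

* S6a `stub_enskogPointwise` is CLOSED: it is the landed `Theorems.EvenStressEnskog.stub_enskogPointwise`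
  (`JParityClosureEvenStressEnskogEnskogPointwise.lean`, p127996 ACCEPTED) — the skeleton imports it and the theorem
  below is a one-line term, no `sorry`.
* WAVE 1 (lead c4): S2 `stub_microStationarity_of` is CLOSED — landed `Theorems.EvenStressEnskog.stub_microStationarity_of`
  (`JParityClosureEvenStressEnskogMicroStationarity.lean`, p133940 ACCEPTED; sure bounds p127926); S6b
  `stub_enskogIdentification_of_pointwise` is CLOSED — landed `Theorems.EvenStressEnskog.stub_enskogIdentification_of_pointwise`
  (`JParityClosureEvenStressEnskogEnskogIdentification.lean`, p134407 ACCEPTED; tools p128422 p129012 p130698).  Hence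
  `MicroStationarity` is an unconditional THEOREM of the tree (`microStationarity_holds` below) and so is the planner-facing
  reduction `CruxOfLocalGibbsTested : LocalGibbsTested → EvenStressEnskog` (`cruxOfLocalGibbsTested_holds` below).
  THREE sorries remain: S3 (bet), S4 (engine), S5 (a-priori tails) — all held by the lead.  Statements and the composition
  are verbatim v2.

## Lead c3 reshape v2 (prover-line-stmt-AtomisticToContinuum-13079-c3-0, continuation seat of lead c2; what changed)

* S1 `stub_clusterTransport` is CLOSED: it is the landed `Theorems.EvenStressEnskog.stub_clusterTransport`
  (`JParityClosureEvenStressEnskogClusterTransport.lean`, p126746 ACCEPTED; helpers p125696 p126113 p126393 p126614) — the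
  skeleton now imports it and the theorem below is a one-line `exact`, no `sorry`.
* S6 `stub_enskogIdentification` is SPLIT (same composition idea, two registered stubs instead of one, total 7):
  - S6a `stub_enskogPointwise` — the exact, `Y`-free, `g`-free POINTWISE second-moment identity for ONE configuration
    `w`, one centre `x`, one pair `(k,l)`, `0 < r`:
    `ρ_r² ⟨Θ(Ξ_P^{kl})⟩_{M⊗M} − B_r(Ξ_P^{kl}) = ρ_r · (ρ_r ⟨F_{kl}(·,u_r,θ_r)⟩_M − ⟨b_r F_{kl}(·,u_r,θ_r)⟩_{μ_w})`,
    `M = localMaxwellian 1 θ_r u_r`, `F_{kl}(v,u,θ) = ∫_{S²} ⟪v − u, ω⟫² ω_k ω_l dσ(ω)` written out as a term (no new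
    definition), `θ_r = mollTemperature`, `u_r = KineticEntropyBalance.uC` — pure algebra (`pairFunctionalP_eq_moment`,
    `sphereMarkP_eq_half`, `integral_prod_empiricalMeasure`) plus the Gaussian second moment `E_{M⊗M}⟪w − v, ω⟫² = 2θ_r`
    (`θ_r > 0`; for `θ_r ≤ 0` the tree's `localMaxwellian 1 θ_r u ≡ 0` and both Maxwellian terms vanish; for `ρ_r = 0`
    all cone weights vanish, `0 < r`);
  - S6b `stub_enskogIdentification_of_pointwise` — S6a (verbatim, as hypothesis) → (L1) (verbatim) → `EnskogSideTested`:
    the `Ỹ`-clamp of the contact value on the analyticity band (`hsEosLowDensity_proof`), the continuous second-moment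
    test function `F_{kl}` and weight `k(a) = g(a)Ỹ(a)a`, integrability of the four `x`-integrands and of the four
    `s`-integrands along good orbits (patterns `EvenStatTruncationBound.integrable_enskogIntegrand`,
    `integrableOn_enskogRate_flow`, `measurable_flow_of_mem_good`), the identity of the two statistics on the good set
    (`localGibbsLaw_compl_good`), and (L1) applied to `(k, F_{kl})`.
  (v2) `EvenStressEnskog_of` took `h2 … h5, h6a, h6b`; (v3, lead c4) it takes only the OPEN `h3 h4 h5` and uses the closed
  S1/S2/S6a/S6b theorems inside.
* Unchanged verbatim: the §1 named statements, S2, S3, S4, S5, the §2 glue, the composition's body.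

Skeleton of the planner (crux-plan, planner-cruxplan-stmt-AtomisticToContinuum-13079-stationary-microscal-0, 2026-08-16;
idea card `Cruxes/EvenStressEnskog/Ideas/stationary-microscale-hierarchy-entrance-law.md`; triage r1-1 PASS / r1-2 PASS /
r1-3 FAIL(costume) — the skeleton ADOPTS r1-3's repair), reshaped by the line lead prover-line-stmt-AtomisticToContinuum-13079-c2-0
(PICKED.md, 2026-08-16).  Direction: POSITIVE — `EvenStressEnskog_of` concludes the crux decl
`Summit.AtomisticToContinuum.HydrodynamicLimit.Theses.JParityClosure.EvenStressEnskog` BY NAME from six registered stubs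
(sorry-free itself; the stubs carry the only `sorry`s of the file); `EvenStressEnskog_proof` is the D-0027 §3.3 shape.

## Lead c2 reshape v1 (what changed w.r.t. the planner's checked skeleton, and why)

* VOCABULARY IN THE TREE.  The §1–§3 functionals (`tupleData … collJump`, `palmData … palmEntPred`, `contactPredM`,
  `oneBodyStat`, `oneBodyPred`) are now `Literature.MathematicalPhysics.KineticTheory.StationaryMicroscale.*`
  (`MicroscaleWindowFunctionals.lean`, p124257 ACCEPTED), with the tree's `mollKineticEnergy` / `mollTemperature` /
  `KineticEntropyBalance.uC` / `hsActivity` for the skeleton's local `mollEnergy` / `mollTemp` / `mollVelocity` / `zact`,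
  and the tree's `speedTailMark` / `tailEnergy` (`CollisionTailMarks.lean`) for the skeleton's verbatim copies
  `relSpeedTail` / `tailKineticEnergy` — so (H_K), (H_E) below are LITERALLY the two antecedents of the landed
  `Theorems.EvenStressEnskog.stub_velocityTruncationOfTails` (p85899).  `G3` is spelled `Torus.geometry (Fin 3)`.
* S1 `stub_clusterTransport`: the support hypothesis is stated on the CLOSED support, `∀ q ∈ tsupport P, ∀ a,
  ε‖(q a).1‖ < 1/2` (the planner's `P q ≠ 0 → …` lets `tsupport P` touch the cut locus `‖sepVec‖ = 1/2`, where the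
  minimal-image separation jumps; the identity stays true there but only through a one-sided `C¹` argument nobody needs:
  S2 absorbs the support condition into `N₀` either way, since `tsupport P` is compact).
* (L1)/(L2) ARE SECOND-MOMENT STATEMENTS.  `OneBodyMaxwellTested` is stated for continuous test functions of QUADRATIC
  velocity growth `|F(v,u,θ)| ≤ C(1 + ‖v‖²)` and `ContactMaxwellTested` for continuous marks with
  `|Ξ(n,v,w)| ≤ C(1 + ‖v‖² + ‖w‖²)` at `‖n‖ = 1` (the planner had BOUNDED `F`, `Ξ`).  Reason (lead finding, recorded as
  `stub-misstated` on the planner's S6): with bounded marks the identification S6 is NOT provable from its named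
  hypotheses — (H_K) `CollisionSpeedTails` yields its truncation level `L₀` AFTER the space scale `r`
  (`∃ r₀ ∀ r < r₀ ∃ L₀ ∀ L ≥ L₀`), while (L2) for the truncated mark `Ξ_L` yields its space threshold `r₀` AFTER the mark
  (`∀ Ξ … ∃ r₀`); for opaque Skolem functions (`r₀(L) = e^{−L}`, `L₀(r) = 1/r`) no pair `(r, L)` satisfies both, so the
  union bound "truncate, then (L2) for `Ξ_L`" cannot be closed, and the same circularity hits the clipping of the quadratic
  test function on the Enskog side against (L1)'s `r₀(F_A)`.  With second-moment (L1)/(L2) — local equilibrium tested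
  against observables of finite ENERGY, which is what the engine S4 must deliver from `AprioriTails` anyway — the contact
  side is the INSTANCE `Ξ := Ξ_P^{kl}` of (L2) (`contactSideTested_of_contactMaxwellTested`, proved below), and the Enskog
  side is an EXACT second-moment identity plus (L1) (S6, no tails, no clipping): all tail content sits in S4/S5.
* S6 `stub_enskogIdentification : OneBodyMaxwellTested → EnskogSideTested` (was `LocalGibbsTested → AprioriTails →
  ContactSideTested ∧ EnskogSideTested`).  `ContactSideTested` / `EnskogSideTested` carry `∀ k l` BEFORE `∀ η δ`; the
  9-fold `min r₀ / max N₀` is done once, in `EvenStressEnskog_of` (`exists_r₀_N₀_forall_fin3`).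
* Unchanged: S2, S3 (the bet), S4 (engine; its output `LocalGibbsTested` is the second-moment pair above), S5.

THE LINE (finite `N`, in the crux's own frame `∃η₀ ∀profiles ∃σ₀ ∀σ ∀Φ ∀τ ∀χ ∀g … ∀η δ ∃r₀ ∀r<r₀ ∃N₀ ∀N≥N₀`, `N → ∞` BEFORE
`r → 0` everywhere — Disproof §4/§9).  FREEZE · ARRIVAL CHAOS · RIGIDITY · IDENTIFICATION.

* FREEZE (S1 `stub_clusterTransport`, S2 `stub_microStationarity_of`; both provable now).  For a FIXED microscale window
  centred at `x₀ ∈ 𝕋³` read the rescaled configuration `(ε⁻¹ sepVec x_k x₀, v_k)_k` through compactly supported `C¹`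
  tuple test functions `P` of every level `m` (`winObs = Σ_ι P(data ι)`), weight it by the crux's `χ(s,x₀) g(σ³ρ_r(x₀))`
  and integrate over `x₀` and `s`.  The exact pathwise transport identity S1 (Eulerian sibling of the PROVED
  `EmpiricalEnskogIdentity`, stmt-13086: the window centre is fixed, so NO spatial derivative of `χ` appears) reads
  `ε[I]₀^τ − ε∫Ẇ·winObs − ∫W·streamObs = ε Σ_coll ∫W·(jump of winObs)`, with HONEST collision sums (internal and
  external partners alike) and pre-collisional velocities read off the right-continuous orbit (`preVelocity`, the crux's
  `pv` convention).  Multiplying by `ε` kills the macroscopic terms: S2 (`MicroStationarity`) — in local-Gibbs probability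
  the streaming functional and the collision functional cancel, `|streamStat + collJump| → 0`, for EVERY compactly
  supported test function of EVERY level and every fixed `r`.
* ARRIVAL CHAOS (S3 `stub_arrivalChaos`, THE BET; hardest).  `∃ R₁ > 1`: in the PALM frame of every particle `p`, the
  particles `q` ENTERING `p`'s microscale sphere `|ξ_pq| = R₁` (approaching relative velocity), jointly with the
  configuration inside that sphere, are distributed as the GNZ ⊗ local-Maxwellian stream (`palmEntFlux ≈ palmEntPred`).
* RIGIDITY (S4 `stub_entranceRigidity`, THE ENGINE, L–XL): `MicroStationarity → ArrivalChaosAt R₁ → AprioriTails →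
  LocalGibbsTested`, `LocalGibbsTested` = (L1) one-body local Maxwellianity at scale `r` ∧ (L2) Enskog contact law with
  contact value `Y`, both for SECOND-MOMENT test functions / marks, tested at finite `N`.
* A-PRIORI (S5 `stub_aprioriTails`): (H_K) ∧ (H_E) — literally the antecedents of the landed `stub_velocityTruncationOfTails`
  — ∧ the route support item `CollisionTightness` (stmt-13085) BY NAME.
* IDENTIFICATION (S6 `stub_enskogIdentification`, M bookkeeping): `OneBodyMaxwellTested → EnskogSideTested` by the exact,
  junk-robust identity `contactPredM(Ξ_P^{kl}) − σ³∫enskogRate(Ξ_P^{kl}) = −[oneBodyStat − oneBodyPred](k := a ↦ g(a)Ỹ(a)a,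
  F_{kl} := (v,u,θ) ↦ ∫_{S²}⟪v − u,ω⟫² ω_kω_l dσ(ω))` on the good set (moment form of `B_r`, `sphereMarkP_eq_half`, second
  Gaussian moments; both sides vanish where `θ_r = 0` because the tree's `localMaxwellian 1 0 u ≡ 0` and `F_{kl}(u,u,·) = 0`).

Composition `EvenStressEnskog_of h1 … h6`: `hMicro := h2 h1`, `⟨R₁, _, hArr⟩ := h3`, `hLG := h4 R₁ _ hMicro hArr h5`,
`hE := h6 hLG.1`, `hC := contactSideTested_of_contactMaxwellTested hLG.2`, then the crux (named form `evenStressEnskog_iff`,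
`Iff.rfl`; `evenStat = collisionSum − σ³∫enskogRate`, `rfl`) by the union bound `{η < |K − E|} ⊆ {η/2 < |K − C|} ∪
{η/2 < |C − E|}` with `C = contactPredM`, pair by pair, and the 9-fold min/max (kernel-checked, sorry-free).

Disproof.lean (cycles 1–2; READ in full by the lead at seat start): NO `_false_without_<H>` theorem exists (§6.2) and no
`-- Targets` stub kill concerns this line; honoured as in the planner's skeleton (§2/§6.1 conventions in `preVelocity`;
§3/§5 `Y`-junk: `contactValue` only under `ρ_r²·g`, S6 uses the analytic continuation `Ỹ`; §4/§9 limit ORDER: `r` fixed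
while `N → ∞` in every stub; §8: (L2)'s trace instance is the impulse-rate law; §10–§11: S6's tool
(`pairFunctionalP_eq_moment`, `sphereMarkP_eq_half`); §12: texture content declared inside S3).
-/

set_option linter.unusedVariables false

noncomputable section

namespace Summit.AtomisticToContinuum.HydrodynamicLimit.Cruxes.EvenStressEnskog.StationaryMicroscaleHierarchyEntranceLaw

open scoped BigOperators InnerProductSpace Topology ENNReal Classical
open MeasureTheory Filter Set
open Literature.MathematicalPhysics.KineticTheory Literature.Analysis.FluidPDE
open Literature.MathematicalPhysics.KineticTheory.StationaryMicroscale
open Summit.AtomisticToContinuum.HydrodynamicLimit.Theses.JParityClosure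

/-! ## §1 Named statements of the line (`Prop`s; the stubs below are these or implications between these) -/

/-- **FREEZE, pathwise — the Eulerian-window CLUSTER TRANSPORT IDENTITY** along ONE good orbit of the `(N+1)`-sphere
flow on `𝕋³` (diameter `ε = hsDiameter σ N`): for `χ` continuous with a continuous `s`-derivative, `g ∈ C¹`, a cone
radius `r < 1/2`, and a compactly supported `C¹` tuple test function `P` of level `m` whose CLOSED position support fits in
the injectivity radius (`ε‖ξ_a‖ < 1/2` on `tsupport P`),
`ε·(I(τ) − I(0)) − ε·∫₀^τ∫ Ẇ·winObs − ∫₀^τ∫ W·streamObs = ε·Σ_{collision times s ∈ (0,τ]} ∫ W·(winObs − winObs∘pre)`,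
`I(s) = ∫_{𝕋³} W(s,x₀) winObs(Φ_s z, x₀) dx₀`, `W = χ(s,x₀) g(σ³ρ_r(Φ_s z, x₀))`, `Ẇ = weightRate` (the a.e.-in-`x₀`
streaming derivative of `W`: the cone kernel is Lipschitz), `streamObs = Σ_ι DP[(v_a,0)_a]` (`ε ×` the time derivative of
`winObs` between collisions — the window centre is FIXED, so no `∇_x χ` term), jumps read with pre-collisional velocities
`preVelocity` (right-continuous orbits; exactly one contact pair at a collision time on good orbits).  The level-`m`,
fixed-centre sibling of the PROVED route support `EmpiricalEnskogIdentity` (stmt-13086) and of the tree's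
`CollisionalTransferTimeDep.sub_eq_integral_add_finsum_collisionJump_td`. [folklore] -/
def ClusterTransportIdentity : Prop :=
  ∀ (σ : ℝ) (N : ℕ), 0 < σ → ∀ Φ : HardSphereFlow (Torus.geometry (Fin 3)) (hsDiameter σ N) (N + 1), ∀ z ∈ Φ.good,
    ∀ τ : ℝ, 0 < τ → ∀ χ : ℝ × T3 → ℝ, Continuous χ → (∀ x₀, Differentiable ℝ fun s => χ (s, x₀)) →
    Continuous (fun p : ℝ × T3 => deriv (fun s => χ (s, p.2)) p.1) →
    ∀ g : ℝ → ℝ, ContDiff ℝ 1 g → ∀ r : ℝ, 0 < r → r < 1 / 2 →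
    ∀ (m : ℕ) (P : (Fin m → V3 × V3) → ℝ), ContDiff ℝ 1 P → HasCompactSupport P →
    (∀ q ∈ tsupport P, ∀ a, hsDiameter σ N * ‖(q a).1‖ < 1 / 2) →
      hsDiameter σ N * (winInt σ N Φ χ g r P τ z - winInt σ N Φ χ g r P 0 z)
        - hsDiameter σ N * wRateStat σ N Φ τ χ g r P z - streamStat σ N Φ τ χ g r P z
        = collJump σ N Φ τ χ g r P z

/-- **FREEZE, tested — MICROSCALE STATIONARITY.**  Along the flow from local Gibbs data, for `χ` continuous with
continuous `s`-derivative, `g ∈ C¹` bounded with bounded derivative (NO density cutoff, NO smallness of the density),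
every level `m`, every compactly supported `C¹` test function `P`, every FIXED `r ∈ (0, 1/2)`:
`P_LG(|streamStat + collJump| > η) ≤ δ` for `N ≥ N₀` — the time-and-`χ`-averaged microscale windows solve the weak
STATIONARY hard-sphere BBGKY hierarchy up to `o(1)`, with honest collision sums as the collision terms. [folklore] -/
def MicroStationarity : Prop :=
  ∀ (a₀ θ₀ : T3 → ℝ) (u₀ : T3 → V3), Continuous a₀ → Continuous θ₀ → Continuous u₀ →
    (∀ x, 0 < a₀ x) → (∀ x, 0 < θ₀ x) → ∃ σ₀ : ℝ, 0 < σ₀ ∧ ∀ σ : ℝ, 0 < σ → σ < σ₀ →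
    ∀ Φ : (N : ℕ) → HardSphereFlow (Torus.geometry (Fin 3)) (hsDiameter σ N) (N + 1), ∀ τ : ℝ, 0 < τ →
    ∀ χ : ℝ × T3 → ℝ, Continuous χ → (∀ x₀, Differentiable ℝ fun s => χ (s, x₀)) →
    Continuous (fun p : ℝ × T3 => deriv (fun s => χ (s, p.2)) p.1) →
    ∀ g : ℝ → ℝ, ContDiff ℝ 1 g → (∃ C : ℝ, ∀ a, |g a| ≤ C) → (∃ C : ℝ, ∀ a, |deriv g a| ≤ C) →
    ∀ (m : ℕ) (P : (Fin m → V3 × V3) → ℝ), ContDiff ℝ 1 P → HasCompactSupport P →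
    ∀ r : ℝ, 0 < r → r < 1 / 2 → ∀ η δ : ℝ, 0 < η → 0 < δ → ∃ N₀ : ℕ, ∀ N : ℕ, N₀ ≤ N →
      localGibbsLaw σ a₀ u₀ θ₀ N (Φ N)
        {z | η < |streamStat σ N (Φ N) τ χ g r P z + collJump σ N (Φ N) τ χ g r P z|} ≤ ENNReal.ofReal δ

/-- **ARRIVAL CHAOS AT SEPARATION `R₁` (the BET), tested at finite `N`.**  `∃ η₀ > 0`: in the crux's frame (profiles,
`σ < σ₀`, any flows, `τ`, continuous `χ`, continuous cutoff `g` vanishing on `[η₀,∞)`), for every level `m` and every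
bounded continuous test function `H(v_p; (ξ_a, v_a)_{a<m}; (ξ_q, v_q))` vanishing unless all `‖ξ_a‖ ≤ R₁` (interior
tuples of `p`'s ball), `∀η δ ∃r₀ ∀r<r₀ ∃N₀ ∀N≥N₀`:  `P_LG(|palmEntFlux H − palmEntPred H| > η) ≤ δ` — the honest sum over
the ENTRANCE EVENTS (`q` crosses `|ξ_pq| = R₁` approaching `p`, weight `ε/(N+1)`, `χ g(σ³ρ_r)` read at `x_p`) of `H`
equals the GNZ ⊗ local-Maxwellian prediction (`hsActivity` at reduced density `η_r = σ³ρ_r`, hard-core vacancy `vacP`,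
local Maxwellian at `(mollTemperature, uC)`).  Limit content: the local state satisfies the GNZ (Nguyen–Zessin) ⊗ Maxwell
equation for the ENTRANCE CLASS of test functions at radius `R₁` — a one-sided (incoming), off-contact (`R₁ > 1`),
partial DLR/Gibbs property with the `r`-SCALE parameters. [folklore] -/
def ArrivalChaosAt (R₁ : ℝ) : Prop :=
  ∃ η₀ : ℝ, 0 < η₀ ∧ ∀ (a₀ θ₀ : T3 → ℝ) (u₀ : T3 → V3), Continuous a₀ → Continuous θ₀ → Continuous u₀ →
    (∀ x, 0 < a₀ x) → (∀ x, 0 < θ₀ x) → ∃ σ₀ : ℝ, 0 < σ₀ ∧ ∀ σ : ℝ, 0 < σ → σ < σ₀ →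
    ∀ Φ : (N : ℕ) → HardSphereFlow (Torus.geometry (Fin 3)) (hsDiameter σ N) (N + 1), ∀ τ : ℝ, 0 < τ →
    ∀ χ : ℝ × T3 → ℝ, Continuous χ → ∀ g : ℝ → ℝ, Continuous g → (∀ a, η₀ ≤ a → g a = 0) →
    ∀ (m : ℕ) (H : V3 × (Fin m → V3 × V3) × (V3 × V3) → ℝ), Continuous H → (∃ C : ℝ, ∀ q, |H q| ≤ C) →
    (∀ q, (∃ a, R₁ < ‖(q.2.1 a).1‖) → H q = 0) →
    ∀ η δ : ℝ, 0 < η → 0 < δ → ∃ r₀ : ℝ, 0 < r₀ ∧ ∀ r : ℝ, 0 < r → r < r₀ → ∃ N₀ : ℕ, ∀ N : ℕ, N₀ ≤ N →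
      localGibbsLaw σ a₀ u₀ θ₀ N (Φ N)
        {z | η < |palmEntFlux σ N (Φ N) τ χ g r R₁ H z - palmEntPred σ N (Φ N) τ χ g r R₁ H z|}
        ≤ ENNReal.ofReal δ

/-- **(H_K) collision-weighted relative-speed tails** — VERBATIM the first antecedent of the landed
`Theorems.EvenStressEnskog.stub_velocityTruncationOfTails` (p85899): the collision sum of the speed-tail mark
`speedTailMark L` is small in local-Gibbs probability for `L ≥ L₀(r)`, `N ≥ N₀(L)`.  Shared a-priori debt of every line of
this crux (rung 0 PROVED: `stub_velocityTailCollisionSumRung0`; `t > 0` open — "never from conservation laws", Disproof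
Targets). [folklore] -/
def CollisionSpeedTails : Prop :=
  ∃ η₀ : ℝ, 0 < η₀ ∧ ∀ (a₀ θ₀ : T3 → ℝ) (u₀ : T3 → V3), Continuous a₀ → Continuous θ₀ → Continuous u₀ →
    (∀ x, 0 < a₀ x) → (∀ x, 0 < θ₀ x) → ∃ σ₀ : ℝ, 0 < σ₀ ∧ ∀ σ : ℝ, 0 < σ → σ < σ₀ →
    ∀ Φ : (N : ℕ) → HardSphereFlow (Torus.geometry (Fin 3)) (hsDiameter σ N) (N + 1), ∀ τ : ℝ, 0 < τ →
    ∀ g : ℝ → ℝ, Continuous g → (∀ a, η₀ ≤ a → g a = 0) → (∀ a, 0 ≤ g a) →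
    ∀ η δ : ℝ, 0 < η → 0 < δ → ∃ r₀ : ℝ, 0 < r₀ ∧ ∀ r : ℝ, 0 < r → r < r₀ →
    ∃ L₀ : ℝ, ∀ L : ℝ, L₀ ≤ L → ∃ N₀ : ℕ, ∀ N : ℕ, N₀ ≤ N →
      localGibbsLaw σ a₀ u₀ θ₀ N (Φ N)
        {z | η < collisionSum σ N (Φ N) τ (fun _ => 1) g (speedTailMark L) r z} ≤ ENNReal.ofReal δ

/-- **(H_E) uniform integrability of the kinetic energy along the flow** — VERBATIM the second antecedent of the landed
`stub_velocityTruncationOfTails`: `E_LG[tailEnergy L (Φ_s z)] ≤ η` for `L ≥ L₀`, `N ≥ N₀`, uniformly in `s ≤ τ`.  Rung 0 and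
`s = 0` PROVED (`stub_velocityTailEnergyRung0`, `stub_velocityTailEnergyTimeZero`); `t > 0` open (relative entropy w.r.t.
the invariant Gibbs law bounds the tail energy by the specific entropy but does not make it vanish). [folklore] -/
def EnergyTails : Prop :=
  ∀ (a₀ θ₀ : T3 → ℝ) (u₀ : T3 → V3), Continuous a₀ → Continuous θ₀ → Continuous u₀ →
    (∀ x, 0 < a₀ x) → (∀ x, 0 < θ₀ x) → ∃ σ₀ : ℝ, 0 < σ₀ ∧ ∀ σ : ℝ, 0 < σ → σ < σ₀ →
    ∀ Φ : (N : ℕ) → HardSphereFlow (Torus.geometry (Fin 3)) (hsDiameter σ N) (N + 1), ∀ τ : ℝ, 0 < τ →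
    ∀ η : ℝ, 0 < η → ∃ L₀ : ℝ, ∀ L : ℝ, L₀ ≤ L → ∃ N₀ : ℕ, ∀ N : ℕ, N₀ ≤ N →
    ∀ s ∈ Set.Icc (0 : ℝ) τ,
      ∫⁻ z, ENNReal.ofReal (tailEnergy L ((Φ N).flow s z)) ∂(localGibbsLaw σ a₀ u₀ θ₀ N (Φ N))
        ≤ ENNReal.ofReal η

/-- **The A-PRIORI PACKAGE** of the line: (H_K) ∧ (H_E) ∧ the route support item `CollisionTightness`
(stmt-AtomisticToContinuum-13085, BY NAME). [folklore] -/
def AprioriTails : Prop := CollisionSpeedTails ∧ EnergyTails ∧ CollisionTightness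

/-- **(L1) ONE-BODY LOCAL MAXWELLIANITY at scale `r`, tested against SECOND-MOMENT test functions** (Eulerian): for
continuous `χ`, a continuous density weight `k` vanishing on `[η₀,∞)` and a continuous `F(v, u, θ)` of second-moment
growth `|F(v,u,θ)| ≤ C(1 + ‖v‖² + ‖u‖² + |θ|)` (read at `u = u_r(x)`, `θ = θ_r(x)`: `ρ_r‖u_r‖² ≤ 2e_r`, `3ρ_rθ_r ≤ 2e_r`),
`∫₀^τ∫ χ k(η_r(x)) ∫ b_r(y,x) F(v, u_r(x), θ_r(x)) dμ_s dx ds ≈ ∫₀^τ∫ χ k(η_r) ρ_r ⟨F(·,u_r,θ_r)⟩_{M_{1,θ_r,u_r}} dx ds`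
in local-Gibbs probability (`N → ∞` at fixed `r`, then `r → 0`).  Limit content: the local velocity law is the Maxwellian with
its own mean and trace-temperature, WITH convergence of second moments (hence ISOTROPIC covariance — what S6 consumes; the
energy tail (H_E) is part of this statement's content, supplied to the engine S4 through `AprioriTails`).  Lead c2 reshape:
bounded `F` ↦ quadratic growth (see the module docstring for the quantifier-circularity reason). [folklore] -/
def OneBodyMaxwellTested : Prop :=
  ∃ η₀ : ℝ, 0 < η₀ ∧ ∀ (a₀ θ₀ : T3 → ℝ) (u₀ : T3 → V3), Continuous a₀ → Continuous θ₀ → Continuous u₀ →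
    (∀ x, 0 < a₀ x) → (∀ x, 0 < θ₀ x) → ∃ σ₀ : ℝ, 0 < σ₀ ∧ ∀ σ : ℝ, 0 < σ → σ < σ₀ →
    ∀ Φ : (N : ℕ) → HardSphereFlow (Torus.geometry (Fin 3)) (hsDiameter σ N) (N + 1), ∀ τ : ℝ, 0 < τ →
    ∀ χ : ℝ × T3 → ℝ, Continuous χ → ∀ k : ℝ → ℝ, Continuous k → (∀ a, η₀ ≤ a → k a = 0) →
    ∀ F : V3 × V3 × ℝ → ℝ, Continuous F →
    (∃ C : ℝ, ∀ q, |F q| ≤ C * (1 + ‖q.1‖ ^ 2 + ‖q.2.1‖ ^ 2 + |q.2.2|)) →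
    ∀ η δ : ℝ, 0 < η → 0 < δ → ∃ r₀ : ℝ, 0 < r₀ ∧ ∀ r : ℝ, 0 < r → r < r₀ → ∃ N₀ : ℕ, ∀ N : ℕ, N₀ ≤ N →
      localGibbsLaw σ a₀ u₀ θ₀ N (Φ N)
        {z | η < |oneBodyStat σ N (Φ N) τ χ k F r z - oneBodyPred σ N (Φ N) τ χ k F r z|}
        ≤ ENNReal.ofReal δ

/-- **(L2) THE ENSKOG CONTACT LAW WITH THE THERMODYNAMIC CONTACT VALUE, Maxwellian velocities, SECOND-MOMENT continuous
marks, tested**: for continuous marks `Ξ` with `|Ξ(n,v,w)| ≤ C(1 + ‖v‖² + ‖w‖²)` at `‖n‖ = 1`,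
`K_N[χ g(σ³ρ_r) Ξ] ≈ σ³∫₀^τ∫ χ g(η_r) Y(η_r) ρ_r² ⟨Θ Ξ⟩_{M⊗M} dx ds` (`contactPredM`; `Y = contactValue` only ever multiplied by
`ρ_r²` and `g`, `η₀` inside the EOS band — Disproof §3/§5) in local-Gibbs probability.  The crux's unbounded marks
`Ξ_P^{kl}` are members of the class (`|Ξ_P| ≤ ‖w − v‖` at unit normal); the relative-speed tail (H_K) is part of this
statement's content, supplied to the engine S4 through `AprioriTails`.  Its trace instance is the impulse-rate law of
Disproof §8 (predicted, not fought).  Lead c2 reshape: bounded `Ξ` ↦ quadratic growth. [folklore] -/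
def ContactMaxwellTested : Prop :=
  ∃ η₀ : ℝ, 0 < η₀ ∧ ∀ (a₀ θ₀ : T3 → ℝ) (u₀ : T3 → V3), Continuous a₀ → Continuous θ₀ → Continuous u₀ →
    (∀ x, 0 < a₀ x) → (∀ x, 0 < θ₀ x) → ∃ σ₀ : ℝ, 0 < σ₀ ∧ ∀ σ : ℝ, 0 < σ → σ < σ₀ →
    ∀ Φ : (N : ℕ) → HardSphereFlow (Torus.geometry (Fin 3)) (hsDiameter σ N) (N + 1), ∀ τ : ℝ, 0 < τ →
    ∀ χ : ℝ × T3 → ℝ, Continuous χ → ∀ g : ℝ → ℝ, Continuous g → (∀ a, η₀ ≤ a → g a = 0) →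
    ∀ Ξ : V3 × V3 × V3 → ℝ, Continuous Ξ →
    (∃ C : ℝ, ∀ q, ‖q.1‖ = 1 → |Ξ q| ≤ C * (1 + ‖q.2.1‖ ^ 2 + ‖q.2.2‖ ^ 2)) →
    ∀ η δ : ℝ, 0 < η → 0 < δ → ∃ r₀ : ℝ, 0 < r₀ ∧ ∀ r : ℝ, 0 < r → r < r₀ → ∃ N₀ : ℕ, ∀ N : ℕ, N₀ ≤ N →
      localGibbsLaw σ a₀ u₀ θ₀ N (Φ N)
        {z | η < |collisionSum σ N (Φ N) τ χ g Ξ r z - contactPredM σ N (Φ N) τ χ g Ξ r z|}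
        ≤ ENNReal.ofReal δ

/-- **LOCAL GIBBSIANITY of the microscale, tested against second-moment observables**: (L1) ∧ (L2) — the output of the
rigidity engine S4 and the input of the identification.  Honest reading (Disproof §6.3): this IS "local equilibrium in the
one-body and two-body contact channels", obtained here as a CONCLUSION from the off-contact bet S3. [folklore] -/
def LocalGibbsTested : Prop := OneBodyMaxwellTested ∧ ContactMaxwellTested

/-- **CONTACT SIDE** for the crux's even marks `Ξ_P^{kl} = evenMark k l`: collision sum ≈ fully Maxwellian Enskog
prediction `contactPredM`, tested in the crux's frame with `∀ k l` BEFORE `∀ η δ` (the 9-fold min/max is done in the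
composition).  Not a stub: the instance `Ξ := Ξ_P^{kl}` of (L2) (`contactSideTested_of_contactMaxwellTested`). [folklore] -/
def ContactSideTested : Prop :=
  ∃ η₀ : ℝ, 0 < η₀ ∧ ∀ (a₀ θ₀ : T3 → ℝ) (u₀ : T3 → V3), Continuous a₀ → Continuous θ₀ → Continuous u₀ →
    (∀ x, 0 < a₀ x) → (∀ x, 0 < θ₀ x) → ∃ σ₀ : ℝ, 0 < σ₀ ∧ ∀ σ : ℝ, 0 < σ → σ < σ₀ →
    ∀ Φ : (N : ℕ) → HardSphereFlow (Torus.geometry (Fin 3)) (hsDiameter σ N) (N + 1), ∀ τ : ℝ, 0 < τ →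
    ∀ χ : ℝ × T3 → ℝ, Continuous χ → ∀ g : ℝ → ℝ, Continuous g → (∀ a, η₀ ≤ a → g a = 0) →
    ∀ k l : Fin 3,
    ∀ η δ : ℝ, 0 < η → 0 < δ → ∃ r₀ : ℝ, 0 < r₀ ∧ ∀ r : ℝ, 0 < r → r < r₀ → ∃ N₀ : ℕ, ∀ N : ℕ, N₀ ≤ N →
      localGibbsLaw σ a₀ u₀ θ₀ N (Φ N)
        {z | η < |collisionSum σ N (Φ N) τ χ g (evenMark k l) r z - contactPredM σ N (Φ N) τ χ g (evenMark k l) r z|}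
        ≤ ENNReal.ofReal δ

/-- **ENSKOG SIDE** for the even marks: fully Maxwellian prediction `contactPredM` ≈ the crux's own Enskog term
`σ³∫₀^τ enskogRate ∘ Φ_s ds` (empirical, h-blind `B_r`), tested in the crux's frame with `∀ k l` BEFORE `∀ η δ`.  Content:
isotropy of the `r`-ball covariance (`B_r^{kl} − ρ_r²⟨Θ^{kl}⟩_{MM} = (8π/15)(ρ_rT_r − m_r⊗m_r − ⅓tr(·)𝟙)_{kl}`, Disproof
§10–§11) — an exact second-moment identity, closed by (L1) with a quadratic test function (S6). [folklore] -/
def EnskogSideTested : Prop :=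
  ∃ η₀ : ℝ, 0 < η₀ ∧ ∀ (a₀ θ₀ : T3 → ℝ) (u₀ : T3 → V3), Continuous a₀ → Continuous θ₀ → Continuous u₀ →
    (∀ x, 0 < a₀ x) → (∀ x, 0 < θ₀ x) → ∃ σ₀ : ℝ, 0 < σ₀ ∧ ∀ σ : ℝ, 0 < σ → σ < σ₀ →
    ∀ Φ : (N : ℕ) → HardSphereFlow (Torus.geometry (Fin 3)) (hsDiameter σ N) (N + 1), ∀ τ : ℝ, 0 < τ →
    ∀ χ : ℝ × T3 → ℝ, Continuous χ → ∀ g : ℝ → ℝ, Continuous g → (∀ a, η₀ ≤ a → g a = 0) →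
    ∀ k l : Fin 3,
    ∀ η δ : ℝ, 0 < η → 0 < δ → ∃ r₀ : ℝ, 0 < r₀ ∧ ∀ r : ℝ, 0 < r → r < r₀ → ∃ N₀ : ℕ, ∀ N : ℕ, N₀ ≤ N →
      localGibbsLaw σ a₀ u₀ θ₀ N (Φ N)
        {z | η < |contactPredM σ N (Φ N) τ χ g (evenMark k l) r z
              - σ ^ 3 * ∫ s in Set.Icc (0 : ℝ) τ, enskogRate σ N χ g (evenMark k l) r s ((Φ N).flow s z)|}
        ≤ ENNReal.ofReal δ

/-! ## §2 Definitional bridge to the crux and elementary glue -/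

/-- `EvenStressEnskog` with its `let`-chain named by the tree's `evenStat` / `evenMark`
(`EvenCollisionTubeFunctional.lean`): `Iff.rfl`. [folklore] -/
theorem evenStressEnskog_iff :
    EvenStressEnskog ↔
    ∃ η₀ : ℝ, 0 < η₀ ∧ ∀ (a₀ θ₀ : T3 → ℝ) (u₀ : T3 → V3), Continuous a₀ → Continuous θ₀ → Continuous u₀ →
      (∀ x, 0 < a₀ x) → (∀ x, 0 < θ₀ x) → ∃ σ₀ : ℝ, 0 < σ₀ ∧ ∀ σ : ℝ, 0 < σ → σ < σ₀ →
      ∀ Φ : (N : ℕ) → HardSphereFlow (Torus.geometry (Fin 3)) (hsDiameter σ N) (N + 1),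
      ∀ τ : ℝ, 0 < τ → ∀ χ : ℝ × UnitAddTorus (Fin 3) → ℝ, Continuous χ → ∀ g : ℝ → ℝ, Continuous g →
      (∀ a, η₀ ≤ a → g a = 0) →
      ∀ η δ : ℝ, 0 < η → 0 < δ → ∃ r₀ : ℝ, 0 < r₀ ∧ ∀ r : ℝ, 0 < r → r < r₀ →
      ∃ N₀ : ℕ, ∀ N : ℕ, N₀ ≤ N → ∀ k l : Fin 3,
        localGibbsLaw σ a₀ u₀ θ₀ N (Φ N) {z | η < |evenStat σ N (Φ N) τ χ g (evenMark k l) r z|}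
          ≤ ENNReal.ofReal δ :=
  Iff.rfl

/-- The 9-fold min/max: per-pair thresholds `r₀(k,l) > 0`, `N₀(k,l,r)` give uniform ones over `Fin 3 × Fin 3`. [folklore] -/
theorem exists_r₀_N₀_forall_fin3 {P : Fin 3 → Fin 3 → ℝ → ℕ → Prop}
    (h : ∀ k l, ∃ r₀ : ℝ, 0 < r₀ ∧ ∀ r : ℝ, 0 < r → r < r₀ → ∃ N₀ : ℕ, ∀ N : ℕ, N₀ ≤ N → P k l r N) :
    ∃ r₀ : ℝ, 0 < r₀ ∧ ∀ r : ℝ, 0 < r → r < r₀ → ∃ N₀ : ℕ, ∀ N : ℕ, N₀ ≤ N → ∀ k l, P k l r N := by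
  choose r₀ hr₀ H using h
  have hne : (Finset.univ : Finset (Fin 3 × Fin 3)).Nonempty := Finset.univ_nonempty
  refine ⟨Finset.univ.inf' hne fun p => r₀ p.1 p.2, ?_, fun r hr hrlt => ?_⟩
  · exact (Finset.lt_inf'_iff hne).2 fun p _ => hr₀ p.1 p.2
  · have hlt : ∀ k l, r < r₀ k l := fun k l =>
      lt_of_lt_of_le hrlt (Finset.inf'_le (fun p : Fin 3 × Fin 3 => r₀ p.1 p.2) (Finset.mem_univ (k, l)))
    choose N₀ HN using fun k l => H k l r hr (hlt k l)
    refine ⟨Finset.univ.sup fun p : Fin 3 × Fin 3 => N₀ p.1 p.2, fun N hN k l => HN k l N ?_⟩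
    exact le_trans (Finset.le_sup (f := fun p : Fin 3 × Fin 3 => N₀ p.1 p.2) (Finset.mem_univ (k, l))) hN

/-- The crux's even marks are continuous second-moment marks: `|Ξ_P^{kl}(n,v,w)| ≤ ‖w − v‖ ≤ 1 + ‖v‖² + ‖w‖²` at unit
normal (`abs_evenMark_le`). [folklore] -/
theorem abs_evenMark_le_quad (k l : Fin 3) (q : V3 × V3 × V3) (hn : ‖q.1‖ = 1) :
    |evenMark k l q| ≤ 1 * (1 + ‖q.2.1‖ ^ 2 + ‖q.2.2‖ ^ 2) := by
  have h1 : |evenMark k l q| ≤ ‖q.2.2 - q.2.1‖ := abs_evenMark_le k l hn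
  have h2 : ‖q.2.2 - q.2.1‖ ≤ ‖q.2.2‖ + ‖q.2.1‖ := norm_sub_le _ _
  have h3 : 0 ≤ ‖q.2.1‖ := norm_nonneg _
  have h4 : 0 ≤ ‖q.2.2‖ := norm_nonneg _
  nlinarith [sq_nonneg (‖q.2.1‖ - 1), sq_nonneg (‖q.2.2‖ - 1)]

/-- **Contact side from (L2)**: the instance `Ξ := Ξ_P^{kl}` (continuous, `continuous_evenMark`; second-moment growth,
`abs_evenMark_le_quad`). [folklore] -/
theorem contactSideTested_of_contactMaxwellTested (h : ContactMaxwellTested) : ContactSideTested := by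
  obtain ⟨η₀, hη₀, H⟩ := h
  refine ⟨η₀, hη₀, fun a₀ θ₀ u₀ ha hθ hu ha0 hθ0 => ?_⟩
  obtain ⟨σ₀, hσ₀, H⟩ := H a₀ θ₀ u₀ ha hθ hu ha0 hθ0
  refine ⟨σ₀, hσ₀, fun σ hσ hσlt Φ τ hτ χ hχ g hg hg0 k l η δ hη hδ => ?_⟩
  exact H σ hσ hσlt Φ τ hτ χ hχ g hg hg0 (evenMark k l) (continuous_evenMark k l)
    ⟨1, fun q hq => abs_evenMark_le_quad k l q hq⟩ η δ hη hδ

/-! ## §3 The six registered stubs (each: the statement `Prop` `Stubs.stub_*`, then the sorried theorem `stub_*`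
with the same text) -/

/-- **S1 · CLUSTER TRANSPORT (FREEZE, pathwise)** — `Stubs.stub_clusterTransport = ClusterTransportIdentity`.
Why true / proof route (PROVABLE NOW, M–L): on a good orbit the collision times in `[0,τ]` are finite and binary
(`IsHardSphereTrajectory.locFinite/binary`), the orbit is free flight in between (`eq_freeFlight`), so
`s ↦ I(s) = ∫ W winObs dx₀` is differentiable between collisions with derivative `∫(Ẇ winObs + ε⁻¹ W streamObs) dx₀` —
differentiate under the `x₀`-integral (`hasDerivAt_integral_of_dominated_loc_of_lip`): for fixed `s` the integrand is
differentiable in `s` off the null set of centres at distance exactly `0` or `r` from a particle (cone kernel kinks) or whose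
cut locus contains a particle, with the Lipschitz bound `3/(πr⁴)·(N+1)⁻¹Σ|v_k|`; `d/ds P(data) = ε⁻¹ DP[(v_a, 0)_a]` because
`d/ds (ε⁻¹ sepVec (x_k + s v_k) x₀) = ε⁻¹ v_k` inside the injectivity radius (closed-support hypothesis: `P ∘ data ≡ 0` near
any cut-locus crossing); the derivative is continuous in `s` along every free flight (dominated convergence), as the engine
`IsHardSphereTrajectory.sub_eq_integral_add_finsum_collisionJump_td` (CollisionalTransferTimeDep) requires for
`F s w := ε ∫ W(s,x₀,w) winObs(w,x₀) dx₀`; at a collision time `I` jumps by `∫ W (winObs − winObs∘preConfig)` (positions,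
hence `W`, are continuous; `preVelocity` returns the left limits of the two colliding velocities by `reflectVel_reflectVel` and
leaves the others unchanged, exactly one pair being in contact: `binary`); convert `∫ in 0..τ` to `∫ in Icc 0 τ`.  `Ioc 0 τ`: a
contact AT time `0` is already post-collisional in `Φ.flow 0 z = z`.  Leans on: `HardSphereFlow.{isTrajectory, flow_zero,
good_subset}`, `IsHardSphereTrajectory.{mem, locFinite, free, binary, eq_freeFlight}`, `freeFlight_apply`, `Torus.geometry`,
`reflectVel_reflectVel`, `collidePair_*`, `mollDensity`, `coneKernel`, `empiricalMeasure_eq`, Mathlib `intervalIntegral`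
FTC, `hasDerivAt_integral_of_dominated_loc_of_lip`, pattern `Theorems.JParityClosureEmpiricalEnskogIdentity`. [folklore] -/
def Stubs.stub_clusterTransport : Prop := ClusterTransportIdentity

/-- S1 — CLOSED (lead c2): the landed `Theorems.EvenStressEnskog.stub_clusterTransport` (p126746), verbatim the
registered signature (`Stubs.stub_clusterTransport` = `ClusterTransportIdentity`). -/
theorem stub_clusterTransport :
  ∀ (σ : ℝ) (N : ℕ), 0 < σ → ∀ Φ : HardSphereFlow (Torus.geometry (Fin 3)) (hsDiameter σ N) (N + 1), ∀ z ∈ Φ.good,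
    ∀ τ : ℝ, 0 < τ → ∀ χ : ℝ × T3 → ℝ, Continuous χ → (∀ x₀, Differentiable ℝ fun s => χ (s, x₀)) →
    Continuous (fun p : ℝ × T3 => deriv (fun s => χ (s, p.2)) p.1) →
    ∀ g : ℝ → ℝ, ContDiff ℝ 1 g → ∀ r : ℝ, 0 < r → r < 1 / 2 →
    ∀ (m : ℕ) (P : (Fin m → V3 × V3) → ℝ), ContDiff ℝ 1 P → HasCompactSupport P →
    (∀ q ∈ tsupport P, ∀ a, hsDiameter σ N * ‖(q a).1‖ < 1 / 2) →
      hsDiameter σ N * (winInt σ N Φ χ g r P τ z - winInt σ N Φ χ g r P 0 z)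
        - hsDiameter σ N * wRateStat σ N Φ τ χ g r P z - streamStat σ N Φ τ χ g r P z
        = collJump σ N Φ τ χ g r P z :=
  Summit.AtomisticToContinuum.HydrodynamicLimit.Theorems.EvenStressEnskog.stub_clusterTransport

/-- **S2 · MICROSCALE STATIONARITY from FREEZE** — `Stubs.stub_microStationarity_of = (ClusterTransportIdentity →
MicroStationarity)`.  Why true / proof route (PROVABLE NOW from S1, M): by S1, `streamStat + collJump = ε(I(τ) − I(0)) −
ε·wRateStat` on good orbits (LG-almost surely, `localGibbsLaw_compl_good`; for `N ≥ N₀` the closed support of `P` — compact,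
inside some `‖ξ_a‖ ≤ R_P` — satisfies `ε R_P < 1/2`).  SURE bounds on the hard-sphere domain (`HardSphereFlow.good_subset`,
`mapsTo_good`): `|winObs| ≤ n_W^m ‖P‖_∞` where `n_W ≤ (2R_P + 1)³` is the packing bound on the number of centres of disjoint
`ε`-spheres within `R_P ε` of `x₀`, so `|ε(I(τ) − I(0))| ≤ 2ε ‖χ‖_∞ ‖g‖_∞ n_W^m ‖P‖_∞ → 0` surely; and
`|Ẇ| ≤ ‖∂_sχ‖_∞‖g‖_∞ + ‖χ‖_∞‖g′‖_∞ σ³ |densRate|` with `|densRate| ≤ 3/(πr⁴) · (N+1)⁻¹Σ_k ‖v_k‖ ≤ 3/(πr⁴) · (2E/(N+1))^{1/2}`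
(Cauchy–Schwarz), the energy per particle being CONSERVED along good orbits and TIGHT under the local Gibbs law — the PROVED
`Theorems.EvenStressEnskog.stub_kineticEnergyTight` (p78074) — so `ε·|wRateStat| ≤ ε τ C(r, χ, g, P) (1 + E/(N+1))` is `≤ η/2`
outside an event of probability `≤ δ` for `N ≥ N₀` (`‖∂_sχ‖_∞ < ∞` on the compact `[0,τ] × 𝕋³`).  No measurability of
`streamStat` is needed: bound the event by the measurable energy event plus the null bad set.  Leans on: S1 (hypothesis),
`stub_kineticEnergyTight`, `isProbabilityMeasure_localGibbsLaw`, `localGibbsLaw_compl_good` (Negative/FrequencyLawReduction),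
`HardSphereFlow.{good_subset, mapsTo_good}`, `measurable_configEnergy`-type lemmas. [folklore] -/
def Stubs.stub_microStationarity_of : Prop := ClusterTransportIdentity → MicroStationarity

/-- S2 — CLOSED (lead c4, wave 1): the landed `Theorems.EvenStressEnskog.stub_microStationarity_of` (p133940), verbatim the
registered signature (`Stubs.stub_microStationarity_of`: hypothesis = `ClusterTransportIdentity` SPELLED OUT verbatim,
conclusion verbatim `MicroStationarity`). -/
theorem stub_microStationarity_of
    (hT : ∀ (σ : ℝ) (N : ℕ), 0 < σ → ∀ Φ : HardSphereFlow (Torus.geometry (Fin 3)) (hsDiameter σ N) (N + 1), ∀ z ∈ Φ.good,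
      ∀ τ : ℝ, 0 < τ → ∀ χ : ℝ × T3 → ℝ, Continuous χ → (∀ x₀, Differentiable ℝ fun s => χ (s, x₀)) →
      Continuous (fun p : ℝ × T3 => deriv (fun s => χ (s, p.2)) p.1) →
      ∀ g : ℝ → ℝ, ContDiff ℝ 1 g → ∀ r : ℝ, 0 < r → r < 1 / 2 →
      ∀ (m : ℕ) (P : (Fin m → V3 × V3) → ℝ), ContDiff ℝ 1 P → HasCompactSupport P →
      (∀ q ∈ tsupport P, ∀ a, hsDiameter σ N * ‖(q a).1‖ < 1 / 2) →
        hsDiameter σ N * (winInt σ N Φ χ g r P τ z - winInt σ N Φ χ g r P 0 z)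
          - hsDiameter σ N * wRateStat σ N Φ τ χ g r P z - streamStat σ N Φ τ χ g r P z
          = collJump σ N Φ τ χ g r P z) :
  ∀ (a₀ θ₀ : T3 → ℝ) (u₀ : T3 → V3), Continuous a₀ → Continuous θ₀ → Continuous u₀ →
    (∀ x, 0 < a₀ x) → (∀ x, 0 < θ₀ x) → ∃ σ₀ : ℝ, 0 < σ₀ ∧ ∀ σ : ℝ, 0 < σ → σ < σ₀ →
    ∀ Φ : (N : ℕ) → HardSphereFlow (Torus.geometry (Fin 3)) (hsDiameter σ N) (N + 1), ∀ τ : ℝ, 0 < τ →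
    ∀ χ : ℝ × T3 → ℝ, Continuous χ → (∀ x₀, Differentiable ℝ fun s => χ (s, x₀)) →
    Continuous (fun p : ℝ × T3 => deriv (fun s => χ (s, p.2)) p.1) →
    ∀ g : ℝ → ℝ, ContDiff ℝ 1 g → (∃ C : ℝ, ∀ a, |g a| ≤ C) → (∃ C : ℝ, ∀ a, |deriv g a| ≤ C) →
    ∀ (m : ℕ) (P : (Fin m → V3 × V3) → ℝ), ContDiff ℝ 1 P → HasCompactSupport P →
    ∀ r : ℝ, 0 < r → r < 1 / 2 → ∀ η δ : ℝ, 0 < η → 0 < δ → ∃ N₀ : ℕ, ∀ N : ℕ, N₀ ≤ N →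
      localGibbsLaw σ a₀ u₀ θ₀ N (Φ N)
        {z | η < |streamStat σ N (Φ N) τ χ g r P z + collJump σ N (Φ N) τ χ g r P z|} ≤ ENNReal.ofReal δ :=
  Summit.AtomisticToContinuum.HydrodynamicLimit.Theorems.EvenStressEnskog.stub_microStationarity_of hT

/-- **S3 · ARRIVAL CHAOS — THE BET (hardest stub)** — `Stubs.stub_arrivalChaos = ∃ R₁ > 1, ArrivalChaosAt R₁`.
Informal: at some fixed microscale separation `R₁ > 1` (diameters), the stream of particles ARRIVING at a tagged
particle's `R₁`-sphere, jointly with everything already inside it, is the grand-canonical Gibbs stream with the local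
`r`-scale parameters: configurationally GNZ (activity `hsActivity(η_r)`, hard-core vacancy against the actual configuration),
kinetically an independent local Maxwellian `M_{1,θ_r,u_r}`, flux-weighted by the approaching normal speed.  Why plausibly
true / why it might fail / honest status: see the planner's card (`Lines/stationary-microscale-hierarchy-entrance-law.md`) —
EXACT at global equilibrium up to `O(1/N)` canonical corrections; deviations are gradient responses `O(Kn)`; might fail by
RING MEMORY or MESOSCALE TEXTURE (Disproof §12, route remark R, `∀τ` frame); a ONE-SIDED (incoming), OFF-CONTACT
local-equilibrium input — the Stosszahlansatz moved from contact to `R₁` (triage r1-3 accepted).  Size: open (crux-depth);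
held by the lead, no worker.  Leans on: `palmEntFlux`, `palmEntPred`, `hsActivity`, `vacP`, `mollDensity/uC/mollTemperature`,
`localMaxwellian`, `sphereMeasure`; NguyenZessin1979, Spohn1991 §4.4, Lanford1975, PulvirentiSimonella2021. [folklore] -/
def Stubs.stub_arrivalChaos : Prop := ∃ R₁ : ℝ, 1 < R₁ ∧ ArrivalChaosAt R₁

/-- Registered stub S3 (`Stubs.stub_arrivalChaos`, verbatim): THE BET. -/
theorem stub_arrivalChaos :
  ∃ R₁ : ℝ, 1 < R₁ ∧
  ∃ η₀ : ℝ, 0 < η₀ ∧ ∀ (a₀ θ₀ : T3 → ℝ) (u₀ : T3 → V3), Continuous a₀ → Continuous θ₀ → Continuous u₀ →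
    (∀ x, 0 < a₀ x) → (∀ x, 0 < θ₀ x) → ∃ σ₀ : ℝ, 0 < σ₀ ∧ ∀ σ : ℝ, 0 < σ → σ < σ₀ →
    ∀ Φ : (N : ℕ) → HardSphereFlow (Torus.geometry (Fin 3)) (hsDiameter σ N) (N + 1), ∀ τ : ℝ, 0 < τ →
    ∀ χ : ℝ × T3 → ℝ, Continuous χ → ∀ g : ℝ → ℝ, Continuous g → (∀ a, η₀ ≤ a → g a = 0) →
    ∀ (m : ℕ) (H : V3 × (Fin m → V3 × V3) × (V3 × V3) → ℝ), Continuous H → (∃ C : ℝ, ∀ q, |H q| ≤ C) →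
    (∀ q, (∃ a, R₁ < ‖(q.2.1 a).1‖) → H q = 0) →
    ∀ η δ : ℝ, 0 < η → 0 < δ → ∃ r₀ : ℝ, 0 < r₀ ∧ ∀ r : ℝ, 0 < r → r < r₀ → ∃ N₀ : ℕ, ∀ N : ℕ, N₀ ≤ N →
      localGibbsLaw σ a₀ u₀ θ₀ N (Φ N)
        {z | η < |palmEntFlux σ N (Φ N) τ χ g r R₁ H z - palmEntPred σ N (Φ N) τ χ g r R₁ H z|}
        ≤ ENNReal.ofReal δ := by
  sorry

/-- **S4 · ENTRANCE RIGIDITY — THE ENGINE** — `Stubs.stub_entranceRigidity = ∀ R₁ > 1, MicroStationarity →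
ArrivalChaosAt R₁ → AprioriTails → LocalGibbsTested` (second-moment (L1) ∧ (L2)).  Proof plan (L–XL; each step a
`--supports` lemma): (a) LOCAL LIMITS of the time-`χ`-weighted microscale empirical fields (tight by packing / (H_E) /
`CollisionTightness` / (H_K)); `MicroStationarity` passes to the limit as the full weak stationary BBGKY hierarchy,
`ArrivalChaosAt R₁` as the GNZ(`hsActivity(η̄)`) ⊗ `M_{1,θ̄,ū}` equation for the Palm entrance class at radius `R₁`.
(b) THE RIGIDITY THEOREM (N-free; new, classical tools): a TI, BBGKY-stationary, hard-core point process with finite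
intensity and energy whose Palm entrance law at radius `R₁` is GNZ(z) ⊗ M IS the Gibbs state `g_{z,u,θ}` for `η̄ < η₀(R₁)` —
INWARD PROPAGATION to a Kirkwood–Salsburg-type contraction `κ⁻ = FreeFlight[GNZ ⊗ M] + 𝒦_η[κ⁻]`, `‖𝒦_η‖ ≤ C η R₁`, with the
Gibbs family as fixed point (DLR + Liouville; finite-`N` shadow `map_flow_localGibbsLaw_const` PROVED), contact value
`Y = (3/2π)F′` on the open band (`HardSphereContactTheorem_holds`, `HsEosLowDensity_holds`), second moments by (H_E)/(H_K).
(c) BACK TO FINITE `N` by the subsequence principle.  Why it might fail / barrier booking: as in the planner's card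
(`BoltzmannHypothesisBarrierNarrow` evasion (iii), scope (b) the residual bet).  Held by the lead; no worker. [folklore] -/
def Stubs.stub_entranceRigidity : Prop :=
  ∀ R₁ : ℝ, 1 < R₁ → MicroStationarity → ArrivalChaosAt R₁ → AprioriTails → LocalGibbsTested

/-- Registered stub S4 (`Stubs.stub_entranceRigidity`: hypotheses by name, conclusion verbatim `LocalGibbsTested`):
THE ENGINE. -/
theorem stub_entranceRigidity (R₁ : ℝ) (hR₁ : 1 < R₁) (hMicro : MicroStationarity) (hArr : ArrivalChaosAt R₁)
    (hTails : AprioriTails) : OneBodyMaxwellTested ∧ ContactMaxwellTested := by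
  sorry

/-- **S5 · A-PRIORI TAILS (shared)** — `Stubs.stub_aprioriTails = AprioriTails = (H_K) ∧ (H_E) ∧ CollisionTightness`.
(H_K), (H_E): literally the antecedents of the landed `stub_velocityTruncationOfTails` (rung 0 proved/landed by lead-0:
`stub_velocityTailCollisionSumRung0`, `stub_velocityTailEnergyRung0/TimeZero`; `t > 0` open: uniform integrability must come
from the law, and relative entropy w.r.t. the invariant Gibbs law only bounds the tail energy by the specific entropy — never
`o(1)`; Disproof Targets); `CollisionTightness` = route support stmt-13085 by name.  Size: L (open beyond rung 0), shared
a-priori debt, not this line's mechanism; held by the lead. [folklore] -/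
def Stubs.stub_aprioriTails : Prop := AprioriTails

/-- Registered stub S5 (`Stubs.stub_aprioriTails` = `AprioriTails`, verbatim conjunction). -/
theorem stub_aprioriTails : CollisionSpeedTails ∧ EnergyTails ∧ CollisionTightness := by
  sorry

/-- **S6 · ENSKOG IDENTIFICATION (bookkeeping, M)** — `Stubs.stub_enskogIdentification = OneBodyMaxwellTested →
EnskogSideTested`.  Proof plan (junk-robust: no Gaussian fourth moments, no sphere fourth moments, exact at `θ_r = 0`).
(i) THE TEST FUNCTION AND THE WEIGHT.  `F_{kl}(v,u,θ) := ∫_{S²} ⟪v − u, ω⟫² ω_k ω_l dσ(ω)` (`sphereMeasure`; continuous,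
`|F_{kl}| ≤ 2·4π(‖v‖² + ‖u‖²)`: a second-moment test function of (L1)) and the CONTINUOUS density weight
`k(a) := g(a)·Ỹ(a)·a`, `Ỹ : ℝ → ℝ` continuous and equal to `Y = contactValue` on `(0, η_Y)` (`HsEosLowDensity_holds` /
`hsEosLowDensity_proof`: `f_ex = F` analytic on the open band, so `Y = (3/2π)·deriv F` there; take e.g.
`Ỹ a := (3/2π)·deriv F (max (min a (η_Y/2)) (η_Y/4))`-type clamp, continuous by `hF.deriv.continuousOn`; the junk value
`Y 0 = 0 ≠ Ỹ 0` (`contactValue_zero`) is killed by the factor `a`), with the stub's `η₀ := min(η₀^{(L1)}, η_Y/2)` so that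
`g(a)Y(a)·a^j = g(a)Ỹ(a)·a^j` for ALL `a ≥ 0`, `j ≥ 1`.
(ii) POINTWISE IDENTITY for one configuration `w` and one centre `x` (write `b_i = b_r(x_i,x)`, `ρ = ρ_r = (N+1)⁻¹Σb_i`,
`S̃₁(ω) = (N+1)⁻¹Σb_i⟪v_i,ω⟫ = ⟪m_r,ω⟫`, `S̃₂(ω) = (N+1)⁻¹Σ b_i⟪v_i,ω⟫²`, `u = uC = ρ⁻¹m_r`, `θ = mollTemperature ≥ 0`):
  ENSKOG SIDE: by the landed `pairFunctionalP_eq_moment` (Negative/EnskogSideMoments, Disproof §11; bodies verbatim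
  `coneKernel`/`sphereMark (evenMark k l)`/`pairFunctional`) `B_r(Ξ_P^{kl})(x) = ∫_ω [ρ S̃₂(ω) − S̃₁(ω)²] ω_kω_l dω`, and
  `(N+1)⁻¹Σ b_i F_{kl}(v_i,u,θ) = ∫_ω [S̃₂ − 2⟪u,ω⟫S̃₁ + ρ⟪u,ω⟫²] ω_kω_l = ∫_ω [S̃₂ − ρ⁻¹S̃₁²] ω_kω_l` (`ρu = m_r`; for
  `ρ = 0` all `b_i = 0` and everything vanishes, `pairFunctional_eq_zero_of_mollifiedDensity_eq_zero`), so
  `B_r^{kl} = ρ · (N+1)⁻¹Σ b_i F_{kl}(v_i, u, θ)`;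
  CONTACT SIDE: `sphereMarkP_eq_half` gives `Θ^{kl}(v,w) = ½∫_ω⟪w − v,ω⟫² ω_kω_l dω`; if `θ > 0`, `M := localMaxwellian 1 θ u`
  is the Gaussian probability density with mean `u` and covariance `θ·id` (Mathlib `gaussianReal` coordinatewise /
  the tree's Maxwellian moment lemmas, `lean search "localMaxwellian"`: `integral_localMaxwellian`, first and second
  moments), so `∫∫ Θ^{kl} M M dv dw = ½∫_ω E_{M⊗M}⟪w−v,ω⟫² ω_kω_l = ∫_ω θ ω_kω_l dω = ⟨F_{kl}(·,u,θ)⟩_M`; if `θ = 0`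
  (or `θ < 0`, impossible by Cauchy–Schwarz but harmless) the tree's `localMaxwellian 1 θ u ≡ 0` (`Real.zero_rpow` /
  `Real.rpow` of a nonpositive base), so BOTH `∫∫Θ MM = 0` and `⟨F⟩_M = 0`.  Hence for EVERY configuration
  `[contactPredM − σ³·enskogRate]`-integrand at `(s,x)` `= σ³χ g(η_r) Y(η_r) ρ[ρ⟨F_{kl}⟩_M − (N+1)⁻¹Σb_iF_{kl}(v_i,u,θ)]`
  `= −[oneBodyStat − oneBodyPred]`-integrand for `(k, F_{kl})` (`k(η_r) = g Ỹ σ³ρ`, (i)).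
(iii) INTEGRABILITY (Disproof §7: no hidden `∫ = 0`), so that the identity of integrands IS the identity
`contactPredM − σ³∫enskogRate = −(oneBodyStat(k,F_{kl}) − oneBodyPred(k,F_{kl}))` on the GOOD set: along `s ↦ Φ_s z`
(`z ∈ Φ.good`) positions are continuous and velocities piecewise constant with finitely many jumps
(`IsHardSphereTrajectory`), `b_r` is continuous and `≤ 3/(πr³)`, so `ρ, m_r, S̃₂` are continuous in `x`, bounded by the
(conserved) energy, and piecewise continuous in `s`; `χ, g, Ỹ` continuous; the `v,w`-integrals are the explicit continuous
functions above ⇒ each of the four `x`-integrands is integrable on `𝕋³` and each `s`-integrand on `[0,τ]` (pattern and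
reusable lemmas: `EvenStatTruncationBound.integrable_enskogIntegrand`, `Theorems.EvenStressEnskog.continuous_mollDensity_comp`,
`continuous_pairFunctional_comp`, `measurable_enskogRate_uncurry`, `measurable_contactValue`); off the good set the law is
null (`localGibbsLaw_compl_good`), so the two events agree up to a null set.  (iv) Apply (L1) to `(k, F_{kl})` at `(η, δ)`
per pair `(k,l)`.  Leans on: (L1) (hypothesis), tree `evenMark`, `sphereMark`, `pairFunctional`, `enskogRate`,
`contactValue`, `localMaxwellian`, `sphereMeasure`, `mollDensity/mollMomentum/mollTemperature/KineticEntropyBalance.uC`,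
`contactPredM/oneBodyStat/oneBodyPred` (MicroscaleWindowFunctionals, p124257), landed `pairFunctionalP_eq_moment`,
`sphereMarkP_eq_half`, `integral_prod_empiricalMeasure`, `empiricalMeasure_eq`, `pairFunctional_eq_zero_of_mollifiedDensity_eq_zero`,
`hsEosLowDensity_proof`, `contactValue_zero`. [folklore] -/
def Stubs.stub_enskogIdentification : Prop := OneBodyMaxwellTested → EnskogSideTested

/-- **S6a · THE POINTWISE SECOND-MOMENT IDENTITY (lead c3 reshape v2; pure algebra + Gaussian second moments, M⁻).**
For ONE configuration `w` of `N + 1` particles, one centre `x`, one pair `(k, l)` and `0 < r`, with `ρ = ρ_r(w, x)`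
(`mollDensity`), `θ = θ_r(w, x)` (`mollTemperature`), `u = u_r(w, x)` (`KineticEntropyBalance.uC`), `M = localMaxwellian 1 θ u`
and the second-moment test function `F_{kl}(v) = ∫_{S²} ⟪v − u, ω⟫² ω_k ω_l dσ(ω)`:
`ρ² ∫∫ Θ(Ξ_P^{kl})(v, v') M(v) M(v') dv dv' − B_r(Ξ_P^{kl})(w, x) = ρ · (ρ ∫ F_{kl} M dv) − ρ · ∫ b_r(y, x) F_{kl}(v) dμ_w(y, v)`.
Proof route.  ENSKOG SIDE: `pairFunctional r (evenMark k l) w x` is, after `dsimp only [pairFunctional, coneKernel, sphereMark,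
evenMark]`, literally the left side of the landed `pairFunctionalP_eq_moment` (Negative/EnskogSideMoments), `=
(N+1)⁻² ∫_ω [S₀ S₂(ω) − S₁(ω)²] ω_k ω_l dω` with `S₀ = Σ b_i`, `S₁ = Σ b_i⟪v_i,ω⟫`, `S₂ = Σ b_i ⟪v_i,ω⟫²`
(`b_i = coneKernel r (w i).1 x`); and `∫ b F_{kl} dμ_w = (N+1)⁻¹ Σ_i b_i ∫_ω ⟪v_i − u, ω⟫² ω_kω_l`
(`integral_empiricalMeasure`-type unfolding, `mollDensity_eq_avg`), `= ∫_ω [(N+1)⁻¹S₂ − 2⟪u,ω⟫⟪m,ω⟫ + ρ⟪u,ω⟫²] ω_kω_l`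
(finite sums commute with the sphere integral: `integral_finset_sum`, continuous integrands on the compact sphere,
`integrable_sphereMeasure_of_continuous_V3`) with `m = mollMomentum = (N+1)⁻¹ Σ b_i v_i`, `(N+1)⁻¹S₁(ω) = ⟪m, ω⟫`; if `ρ ≠ 0`
then `u = ρ⁻¹ m` (`KineticEntropyBalance.uC`) and `ρ · (…) = ∫_ω [ρ (N+1)⁻¹S₂ − ⟪m,ω⟫²] ω_kω_l = B_r` exactly; if `ρ = 0` then
(`0 < r`, `coneKernel ≥ 0`, `coneMollifier_nonneg`) every `b_i = 0`, so `B_r = 0` (`pairFunctional_eq_zero_of_mollifiedDensity_eq_zero`)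
and the right side is `0`.  MAXWELLIAN SIDE: `sphereMark (evenMark k l) v v' = ½ ∫_ω ⟪v' − v, ω⟫² ω_kω_l` (`sphereMarkP_eq_half`,
after `dsimp only [sphereMark, evenMark]`); if `0 < θ`: swap `∫_v ∫_{v'} ∫_ω` (Fubini/Tonelli: the integrand is continuous with
Gaussian × Gaussian × bounded-sphere domination; `integral_localMaxwellian_mul_eq_integral_gaussMeasure`,
`withDensity_localMaxwellian_eq_gaussMeasure`, `integral_gaussMeasure`, Mathlib `IsGaussian` second moments /
`integral_localMaxwellian_mul_affine`-type lemmas in `Theorems.EnskogAdjointDuality*`, `HardSphereEulerProofs.integral_localMaxwellian_smul`)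
and use `E_{M⊗M} ⟪v' − v, ω⟫² = 2θ‖ω‖² = 2θ`, `E_M ⟪v − u, ω⟫² = θ`: both Maxwellian terms equal `ρ²θ ∫_ω ω_kω_l dω`; if
`θ ≤ 0`: `localMaxwellian 1 θ u ≡ 0` (`Real.zero_rpow` / `Real.rpow_def_of_neg` with `cos(−3π/2) = 0`, or better: prove
`0 ≤ mollTemperature` from Cauchy–Schwarz when `0 < r` and treat only `θ = 0`), so both Maxwellian terms are `0`.
Leans on: `pairFunctionalP_eq_moment`, `sphereMarkP_eq_half`, `integral_prod_empiricalMeasure`, `mollDensity_eq_avg`,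
`pairFunctional_eq_double_sum`, `mollKineticEnergy_eq_sum`, `localMaxwellian`, Gaussian moment API (tree + Mathlib). [folklore] -/
def Stubs.stub_enskogPointwise : Prop :=
  ∀ (N : ℕ) (k l : Fin 3) (r : ℝ), 0 < r → ∀ (w : Config (N + 1) (Fin 3) T3) (x : T3),
    mollDensity r w x ^ 2 *
        (∫ v : V3, ∫ v' : V3, sphereMark (evenMark k l) v v' *
          localMaxwellian 1 (mollTemperature r w x) (KineticEntropyBalance.uC r w x) v *
          localMaxwellian 1 (mollTemperature r w x) (KineticEntropyBalance.uC r w x) v')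
      - pairFunctional r (evenMark k l) w x
    = mollDensity r w x *
        (mollDensity r w x *
          ∫ v : V3, (∫ ω : Metric.sphere (0 : V3) 1,
              ⟪v - KineticEntropyBalance.uC r w x, (ω : V3)⟫_ℝ ^ 2 * ((ω : V3) k * (ω : V3) l) ∂sphereMeasure) *
            localMaxwellian 1 (mollTemperature r w x) (KineticEntropyBalance.uC r w x) v)
      - mollDensity r w x *
        ∫ q, coneKernel r q.1 x *
          (∫ ω : Metric.sphere (0 : V3) 1,
              ⟪q.2 - KineticEntropyBalance.uC r w x, (ω : V3)⟫_ℝ ^ 2 * ((ω : V3) k * (ω : V3) l) ∂sphereMeasure)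
          ∂(empiricalMeasure w)

/-- S6a — CLOSED (lead c3): the landed `Theorems.EvenStressEnskog.stub_enskogPointwise` (p127996), verbatim the
registered signature (`Stubs.stub_enskogPointwise`). -/
theorem stub_enskogPointwise :
  ∀ (N : ℕ) (k l : Fin 3) (r : ℝ), 0 < r → ∀ (w : Config (N + 1) (Fin 3) T3) (x : T3),
    mollDensity r w x ^ 2 *
        (∫ v : V3, ∫ v' : V3, sphereMark (evenMark k l) v v' *
          localMaxwellian 1 (mollTemperature r w x) (KineticEntropyBalance.uC r w x) v *
          localMaxwellian 1 (mollTemperature r w x) (KineticEntropyBalance.uC r w x) v')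
      - pairFunctional r (evenMark k l) w x
    = mollDensity r w x *
        (mollDensity r w x *
          ∫ v : V3, (∫ ω : Metric.sphere (0 : V3) 1,
              ⟪v - KineticEntropyBalance.uC r w x, (ω : V3)⟫_ℝ ^ 2 * ((ω : V3) k * (ω : V3) l) ∂sphereMeasure) *
            localMaxwellian 1 (mollTemperature r w x) (KineticEntropyBalance.uC r w x) v)
      - mollDensity r w x *
        ∫ q, coneKernel r q.1 x *
          (∫ ω : Metric.sphere (0 : V3) 1,
              ⟪q.2 - KineticEntropyBalance.uC r w x, (ω : V3)⟫_ℝ ^ 2 * ((ω : V3) k * (ω : V3) l) ∂sphereMeasure)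
          ∂(empiricalMeasure w) :=
  Summit.AtomisticToContinuum.HydrodynamicLimit.Theorems.EvenStressEnskog.stub_enskogPointwise

/-- **S6b · ENSKOG IDENTIFICATION FROM THE POINTWISE IDENTITY (lead c3 reshape v2; bookkeeping + integrability, M).**
`Stubs.stub_enskogIdentification_of_pointwise = (Stubs.stub_enskogPointwise → OneBodyMaxwellTested → EnskogSideTested)`.
Proof route ((i)–(iv) of the S6 docstring above, with (ii) now the hypothesis S6a): (i) from `hsEosLowDensity_proof`
(`= HsEosLowDensity_holds`) get `η_Y > 0` and `F` analytic on `Ioo (−η_Y) η_Y` with `hsExcessFreeEnergy = F` on `Ico 0 η_Y`;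
hence `deriv hsExcessFreeEnergy a = deriv F a` for `a ∈ Ioo 0 η_Y` (`Filter.EventuallyEq.deriv_eq`, the two agree on a
neighbourhood) and `contactValue a = (3/2π) deriv F a` there; put `Ỹ a := (3/2π) · deriv F (max (min a (η_Y/2)) 0)`,
continuous on `ℝ` (`(hF.deriv).continuousOn.comp_continuous` with the clamp into `Icc 0 (η_Y/2) ⊆ Ioo (−η_Y) η_Y`) and
`= contactValue` on `Ioo 0 (η_Y/2]`.  Take the stub's `η₀ := min η₀^{(L1)} (η_Y/2)`; then for EVERY `a ≥ 0`,
`g a * contactValue a * a = g a * Ỹ a * a` (for `0 < a < η₀` by `Ỹ = Y`; for `a ≥ η₀` since `g a = 0`; for `a = 0` by the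
factor `a`).  The weight `k a := g a * Ỹ a * a` is continuous and vanishes on `[η₀^{(L1)}, ∞)`; the test function
`F_{kl} (v, u, θ) := ∫_{S²} ⟪v − u, ω⟫² ω_kω_l dσ(ω) = Σ_{i,j} (v − u)_i (v − u)_j ∫ ω_iω_jω_kω_l dσ` is continuous (a polynomial
in `v − u`: expand the square and use `integral_finset_sum`, or `continuous_of_dominated` on the compact sphere) with
`|F_{kl}(v,u,θ)| ≤ ∫ ‖v − u‖² dσ ≤ 2·sphereMeasure(S²)·(‖v‖² + ‖u‖²) ≤ C(1 + ‖v‖² + ‖u‖² + |θ|)`.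
(ii) For every configuration `w'`, centre `x`, time label `s`: multiply S6a by `χ(s,x) g(σ³ρ) contactValue(σ³ρ)` and use
`g Y σ³ρ · ρ = k(σ³ρ) · ρ`… precisely: the `x`-integrand of `contactPredM` minus `σ³ ×` the `x`-integrand of `enskogRate`
equals MINUS (the `x`-integrand of `oneBodyStat … k F_{kl}` minus that of `oneBodyPred … k F_{kl}`), using
`σ³ · g(σ³ρ) Y(σ³ρ) · ρ · X = k(σ³ρ) · X` (`0 ≤ ρ` from `0 < r`, `mollDensity_nonneg_of_pos`).
(iii) INTEGRABILITY so that the identity of integrands is the identity of the functionals on the good set `z ∈ (Φ N).good`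
(Disproof §7: no hidden Bochner `∫ = 0`): for fixed `s` each of the four `x`-integrands is bounded and measurable on `𝕋³`
(`integrable_enskogIntegrand` is literally the Enskog one; same pattern for the other three: `measurable_coneKernel_comp`,
continuity in `x` of `mollDensity/mollMomentum/mollKineticEnergy` sums, `measurable_contactValue`/`Measurable.deriv`, the
Maxwellian `v`-integrals in closed form from S6a's proof ingredients or bounded via `|∫FM| ≤ C(1+‖u‖²+|θ|)·1`); along the
good orbit `s ↦ (Φ N).flow s z` is measurable (`measurable_flow_of_mem_good`) and the four `x`-integrals are bounded by
`C(1 + E(z)/(N+1))` uniformly in `s ∈ [0,τ]` (conserved kinetic energy, `HardSphereFlow.configEnergy_flow`; pattern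
`integrableOn_enskogRate_flow`), hence integrable on `Icc 0 τ`; conclude with `integral_sub`/`setIntegral` linearity that
`contactPredM − σ³ ∫ enskogRate = −(oneBodyStat k F − oneBodyPred k F)` for `z ∈ (Φ N).good`, so the two events coincide
on the good set and `localGibbsLaw_compl_good` (Negative/FrequencyLawReduction) removes the rest.  (iv) Apply (L1) to
`(χ, k, F_{kl})` at `(η, δ)`, per pair `(k, l)`; thresholds `η₀` as in (i), `σ₀ := σ₀^{(L1)}`, `r₀, N₀` from (L1).
Leans on: S6a (hypothesis), (L1) (hypothesis), `hsEosLowDensity_proof`, `contactValue`, `contactValue_zero`,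
`localGibbsLaw_compl_good`, `EvenStatTruncationBound.{integrable_enskogIntegrand, integrableOn_enskogRate_flow,
measurable_flow_of_mem_good, measurable_enskogRate_prod, mollDensity_nonneg_of_pos}`, `isProbabilityMeasure_localGibbsLaw`.
[folklore] -/
def Stubs.stub_enskogIdentification_of_pointwise : Prop :=
  Stubs.stub_enskogPointwise → OneBodyMaxwellTested → EnskogSideTested

/-- S6b — CLOSED (lead c4, wave 1): the landed `Theorems.EvenStressEnskog.stub_enskogIdentification_of_pointwise` (p134407),
verbatim the registered signature (`Stubs.stub_enskogIdentification_of_pointwise`: hypotheses = S6a `Stubs.stub_enskogPointwise`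
and (L1) `OneBodyMaxwellTested`, both SPELLED OUT verbatim; conclusion verbatim `EnskogSideTested`). -/
theorem stub_enskogIdentification_of_pointwise
    (hPW : ∀ (N : ℕ) (k l : Fin 3) (r : ℝ), 0 < r → ∀ (w : Config (N + 1) (Fin 3) T3) (x : T3),
      mollDensity r w x ^ 2 *
          (∫ v : V3, ∫ v' : V3, sphereMark (evenMark k l) v v' *
            localMaxwellian 1 (mollTemperature r w x) (KineticEntropyBalance.uC r w x) v *
            localMaxwellian 1 (mollTemperature r w x) (KineticEntropyBalance.uC r w x) v')
        - pairFunctional r (evenMark k l) w x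
      = mollDensity r w x *
          (mollDensity r w x *
            ∫ v : V3, (∫ ω : Metric.sphere (0 : V3) 1,
                ⟪v - KineticEntropyBalance.uC r w x, (ω : V3)⟫_ℝ ^ 2 * ((ω : V3) k * (ω : V3) l) ∂sphereMeasure) *
              localMaxwellian 1 (mollTemperature r w x) (KineticEntropyBalance.uC r w x) v)
        - mollDensity r w x *
          ∫ q, coneKernel r q.1 x *
            (∫ ω : Metric.sphere (0 : V3) 1,
                ⟪q.2 - KineticEntropyBalance.uC r w x, (ω : V3)⟫_ℝ ^ 2 * ((ω : V3) k * (ω : V3) l) ∂sphereMeasure)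
            ∂(empiricalMeasure w))
    (hL1 : ∃ η₀ : ℝ, 0 < η₀ ∧ ∀ (a₀ θ₀ : T3 → ℝ) (u₀ : T3 → V3), Continuous a₀ → Continuous θ₀ → Continuous u₀ →
      (∀ x, 0 < a₀ x) → (∀ x, 0 < θ₀ x) → ∃ σ₀ : ℝ, 0 < σ₀ ∧ ∀ σ : ℝ, 0 < σ → σ < σ₀ →
      ∀ Φ : (N : ℕ) → HardSphereFlow (Torus.geometry (Fin 3)) (hsDiameter σ N) (N + 1), ∀ τ : ℝ, 0 < τ →
      ∀ χ : ℝ × T3 → ℝ, Continuous χ → ∀ k : ℝ → ℝ, Continuous k → (∀ a, η₀ ≤ a → k a = 0) →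
      ∀ F : V3 × V3 × ℝ → ℝ, Continuous F →
      (∃ C : ℝ, ∀ q, |F q| ≤ C * (1 + ‖q.1‖ ^ 2 + ‖q.2.1‖ ^ 2 + |q.2.2|)) →
      ∀ η δ : ℝ, 0 < η → 0 < δ → ∃ r₀ : ℝ, 0 < r₀ ∧ ∀ r : ℝ, 0 < r → r < r₀ → ∃ N₀ : ℕ, ∀ N : ℕ, N₀ ≤ N →
        localGibbsLaw σ a₀ u₀ θ₀ N (Φ N)
          {z | η < |oneBodyStat σ N (Φ N) τ χ k F r z - oneBodyPred σ N (Φ N) τ χ k F r z|}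
          ≤ ENNReal.ofReal δ) :
  ∃ η₀ : ℝ, 0 < η₀ ∧ ∀ (a₀ θ₀ : T3 → ℝ) (u₀ : T3 → V3), Continuous a₀ → Continuous θ₀ → Continuous u₀ →
    (∀ x, 0 < a₀ x) → (∀ x, 0 < θ₀ x) → ∃ σ₀ : ℝ, 0 < σ₀ ∧ ∀ σ : ℝ, 0 < σ → σ < σ₀ →
    ∀ Φ : (N : ℕ) → HardSphereFlow (Torus.geometry (Fin 3)) (hsDiameter σ N) (N + 1), ∀ τ : ℝ, 0 < τ →
    ∀ χ : ℝ × T3 → ℝ, Continuous χ → ∀ g : ℝ → ℝ, Continuous g → (∀ a, η₀ ≤ a → g a = 0) →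
    ∀ k l : Fin 3,
    ∀ η δ : ℝ, 0 < η → 0 < δ → ∃ r₀ : ℝ, 0 < r₀ ∧ ∀ r : ℝ, 0 < r → r < r₀ → ∃ N₀ : ℕ, ∀ N : ℕ, N₀ ≤ N →
      localGibbsLaw σ a₀ u₀ θ₀ N (Φ N)
        {z | η < |contactPredM σ N (Φ N) τ χ g (evenMark k l) r z
              - σ ^ 3 * ∫ s in Set.Icc (0 : ℝ) τ, enskogRate σ N χ g (evenMark k l) r s ((Φ N).flow s z)|}
        ≤ ENNReal.ofReal δ :=
  Summit.AtomisticToContinuum.HydrodynamicLimit.Theorems.EvenStressEnskog.stub_enskogIdentification_of_pointwise hPW hL1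

/-! ## §4 The composition (kernel-checked, sorry-free) -/

/-- **S6 from S6a and S6b** (lead c3 reshape v2): `stub_enskogIdentification = S6b ∘ S6a`. [folklore] -/
theorem stub_enskogIdentification_of_split (h6a : Stubs.stub_enskogPointwise)
    (h6b : Stubs.stub_enskogIdentification_of_pointwise) : Stubs.stub_enskogIdentification :=
  h6b h6a

/-- **The crux in its NAMED form (`evenStressEnskog_iff`) from the contact side and the Enskog side** (the union bound
`{η < |K − E|} ⊆ {η/2 < |K − C|} ∪ {η/2 < |C − E|}` with `C = contactPredM`, pair by pair, thresholds `η₀, σ₀ := min`, and the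
9-fold `min r₀ / max N₀`, `exists_r₀_N₀_forall_fin3`).  Stated on the unfolded form so that exactly ONE theorem of this file
(`EvenStressEnskog_of`) concludes the crux decl by name with stub hypotheses. [folklore] -/
theorem evenStressEnskog_named_of_sides (hC : ContactSideTested) (hE : EnskogSideTested) :
    ∃ η₀ : ℝ, 0 < η₀ ∧ ∀ (a₀ θ₀ : T3 → ℝ) (u₀ : T3 → V3), Continuous a₀ → Continuous θ₀ → Continuous u₀ →
      (∀ x, 0 < a₀ x) → (∀ x, 0 < θ₀ x) → ∃ σ₀ : ℝ, 0 < σ₀ ∧ ∀ σ : ℝ, 0 < σ → σ < σ₀ →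
      ∀ Φ : (N : ℕ) → HardSphereFlow (Torus.geometry (Fin 3)) (hsDiameter σ N) (N + 1),
      ∀ τ : ℝ, 0 < τ → ∀ χ : ℝ × UnitAddTorus (Fin 3) → ℝ, Continuous χ → ∀ g : ℝ → ℝ, Continuous g →
      (∀ a, η₀ ≤ a → g a = 0) →
      ∀ η δ : ℝ, 0 < η → 0 < δ → ∃ r₀ : ℝ, 0 < r₀ ∧ ∀ r : ℝ, 0 < r → r < r₀ →
      ∃ N₀ : ℕ, ∀ N : ℕ, N₀ ≤ N → ∀ k l : Fin 3,
        localGibbsLaw σ a₀ u₀ θ₀ N (Φ N) {z | η < |evenStat σ N (Φ N) τ χ g (evenMark k l) r z|}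
          ≤ ENNReal.ofReal δ := by
  obtain ⟨η₄, hη₄, H4⟩ := hC
  obtain ⟨η₅, hη₅, H5⟩ := hE
  refine ⟨min η₄ η₅, lt_min hη₄ hη₅, ?_⟩
  intro a₀ θ₀ u₀ ha hθ hu ha0 hθ0
  obtain ⟨σ₄, hσ₄, H4⟩ := H4 a₀ θ₀ u₀ ha hθ hu ha0 hθ0
  obtain ⟨σ₅, hσ₅, H5⟩ := H5 a₀ θ₀ u₀ ha hθ hu ha0 hθ0
  refine ⟨min σ₄ σ₅, lt_min hσ₄ hσ₅, ?_⟩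
  intro σ hσ hσlt Φ τ hτ χ hχ g hg hg0 η δ hη hδ
  have hσ4 : σ < σ₄ := lt_of_lt_of_le hσlt (min_le_left _ _)
  have hσ5 : σ < σ₅ := lt_of_lt_of_le hσlt (min_le_right _ _)
  have hg4 : ∀ a, η₄ ≤ a → g a = 0 := fun a h => hg0 a ((min_le_left _ _).trans h)
  have hg5 : ∀ a, η₅ ≤ a → g a = 0 := fun a h => hg0 a ((min_le_right _ _).trans h)
  have hη2 : 0 < η / 2 := by positivity
  have hδ2 : 0 < δ / 2 := by positivity
  -- per pair (k, l): thresholds from the contact side and the Enskog side, combined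
  have hpair : ∀ k l : Fin 3, ∃ r₀ : ℝ, 0 < r₀ ∧ ∀ r : ℝ, 0 < r → r < r₀ → ∃ N₀ : ℕ, ∀ N : ℕ, N₀ ≤ N →
      localGibbsLaw σ a₀ u₀ θ₀ N (Φ N) {z | η < |evenStat σ N (Φ N) τ χ g (evenMark k l) r z|}
        ≤ ENNReal.ofReal δ := by
    intro k l
    obtain ⟨r₄, hr₄, H4'⟩ := H4 σ hσ hσ4 Φ τ hτ χ hχ g hg hg4 k l (η / 2) (δ / 2) hη2 hδ2
    obtain ⟨r₅, hr₅, H5'⟩ := H5 σ hσ hσ5 Φ τ hτ χ hχ g hg hg5 k l (η / 2) (δ / 2) hη2 hδ2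
    refine ⟨min r₄ r₅, lt_min hr₄ hr₅, fun r hr hrlt => ?_⟩
    have hr4 : r < r₄ := lt_of_lt_of_le hrlt (min_le_left _ _)
    have hr5 : r < r₅ := lt_of_lt_of_le hrlt (min_le_right _ _)
    obtain ⟨N₄, H4''⟩ := H4' r hr hr4
    obtain ⟨N₅, H5''⟩ := H5' r hr hr5
    refine ⟨max N₄ N₅, fun N hN => ?_⟩
    have E4 := H4'' N ((le_max_left _ _).trans hN)
    have E5 := H5'' N ((le_max_right _ _).trans hN)
    set P := localGibbsLaw σ a₀ u₀ θ₀ N (Φ N) with hP'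
    set K := fun z => collisionSum σ N (Φ N) τ χ g (evenMark k l) r z with hK
    set C := fun z => contactPredM σ N (Φ N) τ χ g (evenMark k l) r z with hC'
    set E := fun z => σ ^ 3 * ∫ s in Set.Icc (0 : ℝ) τ, enskogRate σ N χ g (evenMark k l) r s ((Φ N).flow s z)
      with hE'
    have hD : ∀ z, evenStat σ N (Φ N) τ χ g (evenMark k l) r z = K z - E z := fun z => rfl
    have hsub : {z | η < |evenStat σ N (Φ N) τ χ g (evenMark k l) r z|}
        ⊆ {z | η / 2 < |K z - C z|} ∪ {z | η / 2 < |C z - E z|} := by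
      intro z hz
      simp only [Set.mem_setOf_eq, Set.mem_union] at hz ⊢
      rw [hD z] at hz
      by_contra hcon
      simp only [not_or, not_lt] at hcon
      obtain ⟨h1', h2'⟩ := hcon
      have : |K z - E z| ≤ |K z - C z| + |C z - E z| := abs_sub_le (K z) (C z) (E z)
      linarith
    calc P {z | η < |evenStat σ N (Φ N) τ χ g (evenMark k l) r z|}
        ≤ P ({z | η / 2 < |K z - C z|} ∪ {z | η / 2 < |C z - E z|}) := measure_mono hsub
      _ ≤ P {z | η / 2 < |K z - C z|} + P {z | η / 2 < |C z - E z|} := measure_union_le _ _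
      _ ≤ ENNReal.ofReal (δ / 2) + ENNReal.ofReal (δ / 2) := add_le_add E4 E5
      _ = ENNReal.ofReal δ := by
          rw [← ENNReal.ofReal_add hδ2.le hδ2.le]
          congr 1
          ring
  exact exists_r₀_N₀_forall_fin3
    (P := fun k l r N => localGibbsLaw σ a₀ u₀ θ₀ N (Φ N)
      {z | η < |evenStat σ N (Φ N) τ χ g (evenMark k l) r z|} ≤ ENNReal.ofReal δ) hpair

/-- **`EvenStressEnskog` from the three OPEN stubs S3, S4, S5** (lead c4 reshape v3: S1, S2, S6a, S6b are the CLOSED theorems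
`stub_clusterTransport`, `stub_microStationarity_of`, `stub_enskogPointwise`, `stub_enskogIdentification_of_pointwise` of this file,
used inside): `hMicro := S2 S1`; `R₁` from S3; `hLG := S4 R₁ hMicro S3 S5`; `hE := S6b S6a hLG.1`;
`hC := contactSideTested_of_contactMaxwellTested hLG.2`; then the crux in its named form (`evenStressEnskog_iff`, `Iff.rfl`;
`evenStat = collisionSum − σ³∫enskogRate` by `rfl`) from the contact side `hC` and the Enskog side `hE`
(`evenStressEnskog_named_of_sides`). [folklore] -/
theorem EvenStressEnskog_of
    (h3 : Stubs.stub_arrivalChaos) (h4 : Stubs.stub_entranceRigidity) (h5 : Stubs.stub_aprioriTails) :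
    EvenStressEnskog := by
  obtain ⟨R₁, hR₁, hArr⟩ := h3
  have hMicro : MicroStationarity := stub_microStationarity_of stub_clusterTransport
  have hLG : LocalGibbsTested := h4 R₁ hR₁ hMicro hArr h5
  have hC : ContactSideTested := contactSideTested_of_contactMaxwellTested hLG.2
  have hE : EnskogSideTested := stub_enskogIdentification_of_pointwise stub_enskogPointwise hLG.1
  exact evenStressEnskog_iff.2 (evenStressEnskog_named_of_sides hC hE)

/-- **The skeleton IS the crux proof modulo the registered stubs** (D-0027 §3.3 shape
`theorem <Crux>_proof : <crux decl> := <line>._of stub₃ stub₄ stub₅`): sorry-free itself; its only gaps are the three OPEN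
`stub_*` theorems above (S1, S2, S6a, S6b are closed and used inside `_of`), matched against the statement `Prop`s `Stubs.stub_*`
by `rfl`-unfolding. [folklore] -/
theorem EvenStressEnskog_proof : EvenStressEnskog :=
  EvenStressEnskog_of stub_arrivalChaos stub_entranceRigidity stub_aprioriTails

/-- **The planner-facing reduction** `LocalGibbsTested → EvenStressEnskog`: the crux from the two standard second-moment
local-equilibrium statements (L1) `OneBodyMaxwellTested` ∧ (L2) `ContactMaxwellTested` (named as a `Prop` so that the
skeleton audit sees exactly one crux-concluding theorem with stub hypotheses, `EvenStressEnskog_of`). [folklore] -/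
def CruxOfLocalGibbsTested : Prop := LocalGibbsTested → EvenStressEnskog

/-- **`EvenStressEnskog` from (L1) ∧ (L2) and the identification alone** (lead c3, planner-facing): the composition uses
S1–S5 ONLY to produce `LocalGibbsTested`; modulo the bookkeeping stubs S6a/S6b the crux follows from the two standard
second-moment local-equilibrium statements `OneBodyMaxwellTested ∧ ContactMaxwellTested` (in) — crux (out). [folklore] -/
theorem cruxOfLocalGibbsTested_of_split (h6a : Stubs.stub_enskogPointwise)
    (h6b : Stubs.stub_enskogIdentification_of_pointwise) : CruxOfLocalGibbsTested := fun hLG =>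
  evenStressEnskog_iff.2
    (evenStressEnskog_named_of_sides (contactSideTested_of_contactMaxwellTested hLG.2) (h6b h6a hLG.1))

/-- **MICROSCALE STATIONARITY IS A THEOREM** (lead c4): S2 applied to the closed S1. [folklore] -/
theorem microStationarity_holds : MicroStationarity :=
  stub_microStationarity_of stub_clusterTransport

/-- **ENSKOG IDENTIFICATION IS A THEOREM** (lead c4): `OneBodyMaxwellTested → EnskogSideTested`, S6b applied to the closed
S6a. [folklore] -/
theorem enskogIdentification_holds : Stubs.stub_enskogIdentification :=
  stub_enskogIdentification_of_split stub_enskogPointwise stub_enskogIdentification_of_pointwise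

/-- **THE CRUX FROM (L1) ∧ (L2), UNCONDITIONALLY** (lead c4): `LocalGibbsTested → EvenStressEnskog` with no stub hypothesis
left — the crux is reduced to the two standard second-moment local-equilibrium statements `OneBodyMaxwellTested`
(one-body local Maxwellianity at scale `r`) and `ContactMaxwellTested` (Enskog contact law with the thermodynamic contact
value for second-moment marks). [folklore] -/
theorem cruxOfLocalGibbsTested_holds : CruxOfLocalGibbsTested :=
  cruxOfLocalGibbsTested_of_split stub_enskogPointwise stub_enskogIdentification_of_pointwise

end Summit.AtomisticToContinuum.HydrodynamicLimit.Cruxes.EvenStressEnskog.StationaryMicroscaleHierarchyEntranceLaw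

end
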